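import Mathlib
import HarnessLib
import Summits.Ventures.LatticeQCDFlow.Scaling.GeneralLayerESSFloorSharp
import Summits.Ventures.LatticeQCDFlow.Scaling.KishSampleSize

/-!
# GeneralLayerSampleSize — HOW MANY INDEPENDENT EVOLUTIONS: `N ≥ exp(t + 2τ̄(θ₂)·σ̄²/n)` forward
# evolutions of the `n`-step protocol with ANY `χ²`-contracting layers suffice for the Jarzynski /
# reweighting estimators (the certified ESS floor fed into Chatterjee–Diaconis)

HONEST FRAMING: exact (Metropolis-corrected) sampling algorithms for lattice gauge theory;
figures of merit are autocorrelation/cost numbers at stated couplings and volumes; no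
continuum-physics claim.

Venture `LatticeQCDFlow` (cell pub-lqcd), topic `Scaling`; FANOUT row 19 (`su2-snf`, GEN-7).
OUR WORK (a composition of this seat's files, nothing cited as a fact): the `2τ̄` ESS floor
`ÊSS ≥ exp(−((1+θ₂)/(1−θ₂))·σ̄²/n)`, `θ₂ = ρe^{3ΔD/n}` (`Scaling/GeneralLayerESSFloorSharp`, general
positive Boltzmann-invariant layers `χ²`-contracting towards their targets with `ρ`,
`|D x − D y| ≤ ΔD`, `Var_c(D) ≤ σ̄²`), and the Chatterjee–Diaconis sufficiency in its ESS form
`N ≥ e^{t}/ÊSS` (`Scaling/KishSampleSize.jarzynski_sampleSize_sufficient_of_ess`, from the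
Literature's `ImportanceSampling/ChatterjeeDiaconis` via `Scaling/JarzynskiSampleSize`).

* **`jarzynski_sampleSize_sufficient_uniform`** — along the uniform grid `c_k = k/n` with such
  layers, if `θ₂ < 1` and `N ≥ exp(t + ((1+θ₂)/(1−θ₂))·σ̄²/n)` then for every path functional `f`
  the Jarzynski-reweighted average of `N` INDEPENDENT forward evolutions satisfies
  `E|(1/N)Σᵢ f(ωⁱ)e^{−(Wᵢ−ΔF)} − ⟨f⟩_R̃| ≤ √⟨f²⟩_R̃·(e^{−t/4} + 2√(P̃_R{W < ⟨W⟩_R̃ − t/2}))`;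
* `jarzynski_sampleSize_sufficient_uniform_of_reversible` — the instance `ρ = max_k λ⋆(P_k)` for
  reversible irreducible positive layers.

READING (value-free): in E7's variables (`−log ESS = k′·n_dof/n_step`, `k′ = 2τ_int σ²Δ²`) the
number of independent evolutions that suffices for reweighting is `e^{t}·e^{k′ n_dof/n_step}` up to
the change-of-reference factor inside `θ₂`; the NECESSITY side (`N ≈ exp D(P̃_R‖P_F)`, the reverse
dissipation, `≤ −log ÊSS`) is `Scaling/JarzynskiSampleSize.jarzynski_sampleSize_necessary`.
NOT CLAIMED: correlated (restart-chain) evolutions; the sample Kish fraction; any value of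
`ρ`, `σ̄`, `ΔD` for a lattice kernel.
-/

namespace Summit.Ventures.LatticeQCDFlow.Theory2

open Finset MeasureTheory
open Literature.Probability.MarkovChains (IsRowStochastic IsStationary DetailedBalance IsIrreducible
  lambdaStar lambdaStar_nonneg)
open Summit.Ventures.LatticeQCDFlow.Exactness
open Summit.Ventures.LatticeQCDFlow.Scaling

variable {X : Type*} [Fintype X] [Nonempty X] [MeasurableSpace X] [MeasurableSingletonClass X]

/-- **HOW MANY INDEPENDENT EVOLUTIONS SUFFICE (general layers, uniform grid).**  Under the
hypotheses of `Scaling.exp_le_ess_path_uniform_sharp` (positive layers with unit row sums leaving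
the Boltzmann weights of their targets invariant and `χ²`-contracting towards them with `ρ ≥ 0`;
`|D x − D y| ≤ ΔD`; `Var_c(D) ≤ σ̄²`; `θ₂ = ρe^{3ΔD/n} < 1`), every `t ≥ 0` and every
`N ≥ exp(t + ((1+θ₂)/(1−θ₂))·σ̄²/n)`: the Jarzynski-reweighted average of any path functional `f`
over `N` independent forward evolutions estimates `⟨f⟩_R̃` with
`E|error| ≤ √⟨f²⟩_R̃·(e^{−t/4} + 2√(P̃_R{W < ⟨W⟩_R̃ − t/2}))`. -/
theorem jarzynski_sampleSize_sufficient_uniform (S₀ D : X → ℝ) (P : ℕ → X → X → ℝ) {n : ℕ}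
    (hn : n ≠ 0) {ΔD ρ σbar t : ℝ} (hD : ∀ x y, |D x - D y| ≤ ΔD) (hPpos : ∀ k x y, 0 < P k x y)
    (hst : ∀ k, IsStationary
      (fun x => Real.exp (-(linAction S₀ D (((k + 1 : ℕ) : ℝ) / n) x))) (P k))
    (hProw : ∀ k x, ∑ y, P k x y = 1)
    (hK : ∀ k, ChiSqContracts (P k) (gibbsLaw (linAction S₀ D (((k + 1 : ℕ) : ℝ) / n))) ρ)
    (hρ : 0 ≤ ρ) (hσ0 : 0 ≤ σbar) (hσ : ∀ c, varD S₀ D c ≤ σbar ^ 2)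
    (hθ1 : ρ * Real.exp (3 * ΔD / n) < 1) (ht : 0 ≤ t)
    (f : (Fin (n + 1) → X) → ℝ) {N : ℕ}
    (hN : Real.exp (t + (1 + ρ * Real.exp (3 * ΔD / n)) / (1 - ρ * Real.exp (3 * ΔD / n))
        * (σbar ^ 2 / n)) ≤ N) :
    ∫ x, |(1 / (N : ℝ)) * ∑ i, f (x i)
          * Real.exp (-(work (fun k : Fin (n + 1) => linAction S₀ D ((k : ℝ) / n)) (x i)
            - (freeEnergy (linAction S₀ D (((Fin.last n : Fin (n + 1)) : ℝ) / n))
              - freeEnergy (linAction S₀ D (((0 : Fin (n + 1)) : ℝ) / n)))))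
        - ∑ ω, revPathLaw (fun k : Fin (n + 1) => linAction S₀ D ((k : ℝ) / n))
            (fun k : Fin n => P k) ω * f ω|
        ∂(Measure.pi fun _ : Fin N =>
          pathMeasure (fun k : Fin (n + 1) => linAction S₀ D ((k : ℝ) / n)) (fun k : Fin n => P k)
            (fun k x => hProw k x) (fun k x y => hPpos k x y))
      ≤ Real.sqrt (∑ ω, revPathLaw (fun k : Fin (n + 1) => linAction S₀ D ((k : ℝ) / n))
            (fun k : Fin n => P k) ω * f ω ^ 2) *
          (Real.exp (-t / 4) + 2 * Real.sqrt
            (∑ ω, if work (fun k : Fin (n + 1) => linAction S₀ D ((k : ℝ) / n)) ω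
                < (∑ ω', revPathLaw (fun k : Fin (n + 1) => linAction S₀ D ((k : ℝ) / n))
                    (fun k : Fin n => P k) ω'
                      * work (fun k : Fin (n + 1) => linAction S₀ D ((k : ℝ) / n)) ω') - t / 2
              then revPathLaw (fun k : Fin (n + 1) => linAction S₀ D ((k : ℝ) / n))
                (fun k : Fin n => P k) ω else 0)) := by
  have hst' : ∀ k : Fin n, IsStationary
      (fun x => Real.exp (-((fun k : Fin (n + 1) => linAction S₀ D ((k : ℝ) / n)) k.succ x)))
      ((fun k : Fin n => P k) k) := by
    intro k; simpa only [Fin.val_succ] using hst k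
  have hfloor := exp_le_ess_path_uniform_sharp S₀ D P hn hD hPpos hst hProw hK hρ hσ0 hσ hθ1
  refine jarzynski_sampleSize_sufficient_of_ess _ _ (fun k x => hProw k x) (fun k x y => hPpos k x y)
    hst' f ht (le_trans ?_ hN)
  have hE : 0 < essFrac
      (revPathLaw (fun k : Fin (n + 1) => linAction S₀ D ((k : ℝ) / n)) (fun k : Fin n => P k))
      (pathLaw (gibbsLaw (linAction S₀ D (((0 : Fin (n + 1)) : ℝ) / n))) (fun k : Fin n => P k)) :=
    lt_of_lt_of_le (Real.exp_pos _) hfloor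
  rw [div_le_iff₀ hE, Real.exp_add, mul_assoc]
  -- `exp(C) * ESS ≥ exp(C) * exp(-C) = 1`
  have h := mul_le_mul_of_nonneg_left hfloor (Real.exp_pos
    ((1 + ρ * Real.exp (3 * ΔD / n)) / (1 - ρ * Real.exp (3 * ΔD / n)) * (σbar ^ 2 / n))).le
  rw [← Real.exp_add, add_neg_cancel, Real.exp_zero] at h
  calc Real.exp t = Real.exp t * 1 := (mul_one _).symm
    _ ≤ _ := mul_le_mul_of_nonneg_left h (Real.exp_pos _).le

/-- **Reversible instance**: `ρ = max_k λ⋆(P_k)` for positive irreducible layers in detailed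
balance with their Gibbs targets. -/
theorem jarzynski_sampleSize_sufficient_uniform_of_reversible [DecidableEq X] (S₀ D : X → ℝ)
    (P : ℕ → X → X → ℝ) {n : ℕ} (hn : n ≠ 0) {ΔD ρ σbar t : ℝ} (hD : ∀ x y, |D x - D y| ≤ ΔD)
    (hP : ∀ k, IsRowStochastic (P k)) (hPpos : ∀ k x y, 0 < P k x y)
    (hDB : ∀ k, DetailedBalance (gibbsLaw (linAction S₀ D (((k + 1 : ℕ) : ℝ) / n))) (P k))
    (hirr : ∀ k, IsIrreducible (P k)) (hlam : ∀ k, lambdaStar (P k) ≤ ρ)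
    (hσ0 : 0 ≤ σbar) (hσ : ∀ c, varD S₀ D c ≤ σbar ^ 2)
    (hθ1 : ρ * Real.exp (3 * ΔD / n) < 1) (ht : 0 ≤ t)
    (f : (Fin (n + 1) → X) → ℝ) {N : ℕ}
    (hN : Real.exp (t + (1 + ρ * Real.exp (3 * ΔD / n)) / (1 - ρ * Real.exp (3 * ΔD / n))
        * (σbar ^ 2 / n)) ≤ N) :
    ∫ x, |(1 / (N : ℝ)) * ∑ i, f (x i)
          * Real.exp (-(work (fun k : Fin (n + 1) => linAction S₀ D ((k : ℝ) / n)) (x i)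
            - (freeEnergy (linAction S₀ D (((Fin.last n : Fin (n + 1)) : ℝ) / n))
              - freeEnergy (linAction S₀ D (((0 : Fin (n + 1)) : ℝ) / n)))))
        - ∑ ω, revPathLaw (fun k : Fin (n + 1) => linAction S₀ D ((k : ℝ) / n))
            (fun k : Fin n => P k) ω * f ω|
        ∂(Measure.pi fun _ : Fin N =>
          pathMeasure (fun k : Fin (n + 1) => linAction S₀ D ((k : ℝ) / n)) (fun k : Fin n => P k)
            (fun k x => (hP k).2 x) (fun k x y => hPpos k x y))
      ≤ Real.sqrt (∑ ω, revPathLaw (fun k : Fin (n + 1) => linAction S₀ D ((k : ℝ) / n))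
            (fun k : Fin n => P k) ω * f ω ^ 2) *
          (Real.exp (-t / 4) + 2 * Real.sqrt
            (∑ ω, if work (fun k : Fin (n + 1) => linAction S₀ D ((k : ℝ) / n)) ω
                < (∑ ω', revPathLaw (fun k : Fin (n + 1) => linAction S₀ D ((k : ℝ) / n))
                    (fun k : Fin n => P k) ω'
                      * work (fun k : Fin (n + 1) => linAction S₀ D ((k : ℝ) / n)) ω') - t / 2
              then revPathLaw (fun k : Fin (n + 1) => linAction S₀ D ((k : ℝ) / n))
                (fun k : Fin n => P k) ω else 0)) := by
  have hρ : 0 ≤ ρ := (lambdaStar_nonneg (P 0)).trans (hlam 0)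
  exact jarzynski_sampleSize_sufficient_uniform S₀ D P hn hD hPpos
    (fun k => isStationary_exp_of_detailedBalance_gibbsLaw (hDB k) (hP k).2)
    (fun k => (hP k).2) (fun k => (chiSqContracts_of_reversible (gibbsLaw_pos _) (sum_gibbsLaw _)
      (hP k) (hDB k) (hirr k)).mono (fun x => (gibbsLaw_pos _ x).le) (lambdaStar_nonneg _) (hlam k))
    hρ hσ0 hσ hθ1 ht f hN

end Summit.Ventures.LatticeQCDFlow.Theory2
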